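import Summits.RiemannHypothesis.RiemannHypothesis.Theorems.PfPersistenceDefectiveTransportShapeSector
import HarnessLib

/-!
# PF persistence campaign (cell `pub-rhpf`, leaf G1.22 TRANSPORT-1, gen 10): the transport kernel of
record, part 10b — SECTOR Ω-FORMS AGAINST AN ARBITRARY UNBOUNDED CLOCK

Honest framing (verbatim, applies to every line): mechanism/rigidity campaign; no RH claims.

Part 8 proved the parity-free Ω-form against ANY strictly increasing clock `ψ`
(`not_riemannHypothesis_of_concaveOn_clock`: eventual concavity of `t ↦ ε (ψ t)` refutes RH, by the
STRICT decrease of `ε = weilGroundEnergy`).  Part 9 proved the sector Ω-forms (`ε_od`, `ε_ev`) only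
against the exponential clocks `t = e^{κa}`, because the sector bottoms are merely antitone and the
argument there went through "concave against `e^{κa}` ⟹ concave in `a`".  This file removes that
asymmetry as far as the tree allows: for ANY non-decreasing clock `ψ` on `[t₀, ∞)` that is UNBOUNDED
above (`∀ A, ∃ t ≥ t₀, A ≤ ψ t`; e.g. `e^{κa}`, `a^p`, `log a`, iterated exponentials — every clock
of TRANSPORT-TABLES L13/L15), eventual concavity of `t ↦ ε_od (ψ t)` or of `t ↦ ε_ev (ψ t)` refutes
RH (§2). Mechanism (§1, abstract): under RH the sector bottom has the floor `0`; a concave function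
with a floor never drops (part 9 `noDrop_of_concaveOn_of_le`); an antitone function that never drops
is constant (part 9 `eq_of_noDrop_of_antitoneOn`); an unbounded clock spreads that constancy over
the whole half-line `[ψ t₀, ∞)`; and neither sector bottom is eventually constant (part 9,
unconditional). The parity-free row gains the same non-strict/unbounded variant (§2, last theorem).

Precise residual (NOT claimed either way): for a BOUNDED strictly increasing clock (`sup ψ = L < ∞`)
sector concavity under RH only forces `ε_od` (resp. `ε_ev`) to be constant on the bounded range
`[ψ t₀, L)`, which no theorem in the tree excludes (strict decrease is known for `ε` only —
Bombieri's window monotonicity — not for the sector bottoms).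

Every shape hypothesis below is asserted of nothing; every conclusion is `¬ RiemannHypothesis`
from that hypothesis or an abstract real-analysis lemma; no reach number is produced.

Statement index (continues part 10, (65)–(89)): (90) `antitoneOn_comp_clock`,
(91) `clock_const_of_concaveOn_of_le`, (92) `const_of_unbounded_clock_const`,
(93) `const_of_concaveOn_unbounded_clock`, (94) `not_riemannHypothesis_of_concaveOn_clock_odd`,
(95) `not_riemannHypothesis_of_concaveOn_clock_even`,
(96) `not_riemannHypothesis_of_concaveOn_clock_mono`,
(97) `not_concaveOn_clock_sectors_of_riemannHypothesis`.

References: E. Bombieri, Rend. Mat. Acc. Lincei (9) 11 (2000) §4 Thm 5; H. Yoshida, Adv. Stud.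
Pure Math. 21 (1992) Prop. 1; A. Connes, C. Consani, H. Moscovici, arXiv:2511.22755 §3.
-/

noncomputable section

set_option linter.dupNamespace false

namespace Summit.RiemannHypothesis.RiemannHypothesis.Theorems.PfPersistenceDefectiveTransport

open Set
open _root_.Literature.NumberTheory.LFunctions
open _root_.Summit.RiemannHypothesis.RiemannHypothesis.Theorems.WeilWindowFlowGronwallLeakage
  (weilGroundEnergy_strictAntiOn)

/-! ## §1 Abstract: concave clock functions with a floor are constant; unbounded clocks spread it -/

/-- The clock function `t ↦ F (ψ t)` of an `F` antitone on `(0, ∞)` along a non-decreasing clock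
`ψ` with `ψ t₀ > 0` is antitone on `[t₀, ∞)`. RH-free. [folklore] -/
theorem antitoneOn_comp_clock {F ψ : ℝ → ℝ} {t₀ : ℝ} (hF : AntitoneOn F (Ioi 0))
    (hψ : MonotoneOn ψ (Ici t₀)) (hψ0 : 0 < ψ t₀) :
    AntitoneOn (fun t : ℝ => F (ψ t)) (Ici t₀) := by
  intro x hx y hy hxy
  have hx0 : 0 < ψ x := hψ0.trans_le (hψ self_mem_Ici hx (mem_Ici.1 hx))
  have hle : ψ x ≤ ψ y := hψ hx hy hxy
  exact hF (mem_Ioi.2 hx0) (mem_Ioi.2 (hx0.trans_le hle)) hle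

/-- **A concave clock function with a floor is constant** (`F` antitone on `(0, ∞)`, `ψ`
non-decreasing on `[t₀, ∞)`, `ψ t₀ > 0`, `t ↦ F (ψ t)` concave on `[t₀, ∞)` and `≥ m` there).
RH-free. [folklore] -/
theorem clock_const_of_concaveOn_of_le {F ψ : ℝ → ℝ} {t₀ m : ℝ} (hF : AntitoneOn F (Ioi 0))
    (hψ : MonotoneOn ψ (Ici t₀)) (hψ0 : 0 < ψ t₀)
    (hconc : ConcaveOn ℝ (Ici t₀) (fun t : ℝ => F (ψ t)))
    (hm : ∀ t : ℝ, t₀ ≤ t → m ≤ F (ψ t)) :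
    ∀ t : ℝ, t₀ ≤ t → F (ψ t) = F (ψ t₀) := fun _ ht =>
  eq_of_noDrop_of_antitoneOn (f := fun t : ℝ => F (ψ t)) (antitoneOn_comp_clock hF hψ hψ0)
    (fun _ _ hx hxy => noDrop_of_concaveOn_of_le hconc hm hx hxy) ht

/-- **An unbounded clock spreads constancy over the half-line**: if `F (ψ t) = F (ψ t₀)` for all
`t ≥ t₀` and `ψ` is unbounded above on `[t₀, ∞)`, then `F ≡ F (ψ t₀)` on `[ψ t₀, ∞)` (`F` antitone
on `(0, ∞)`, `ψ t₀ > 0`). RH-free. [folklore] -/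
theorem const_of_unbounded_clock_const {F ψ : ℝ → ℝ} {t₀ : ℝ} (hF : AntitoneOn F (Ioi 0))
    (hψ0 : 0 < ψ t₀) (hunb : ∀ A : ℝ, ∃ t : ℝ, t₀ ≤ t ∧ A ≤ ψ t)
    (h : ∀ t : ℝ, t₀ ≤ t → F (ψ t) = F (ψ t₀)) :
    ∀ a : ℝ, ψ t₀ ≤ a → F a = F (ψ t₀) := by
  intro a ha
  obtain ⟨t, ht, hat⟩ := hunb a
  have ha0 : 0 < a := hψ0.trans_le ha
  have h1 : F a ≤ F (ψ t₀) := hF (mem_Ioi.2 hψ0) (mem_Ioi.2 ha0) ha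
  have h2 : F (ψ t) ≤ F a := hF (mem_Ioi.2 ha0) (mem_Ioi.2 (ha0.trans_le hat)) hat
  rw [h t ht] at h2
  exact le_antisymm h1 h2

/-- The two steps combined: a concave clock function with a floor along an unbounded
non-decreasing clock forces `F` to be constant on `[ψ t₀, ∞)`. RH-free. [folklore] -/
theorem const_of_concaveOn_unbounded_clock {F ψ : ℝ → ℝ} {t₀ m : ℝ} (hF : AntitoneOn F (Ioi 0))
    (hψ : MonotoneOn ψ (Ici t₀)) (hψ0 : 0 < ψ t₀) (hunb : ∀ A : ℝ, ∃ t : ℝ, t₀ ≤ t ∧ A ≤ ψ t)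
    (hconc : ConcaveOn ℝ (Ici t₀) (fun t : ℝ => F (ψ t)))
    (hm : ∀ t : ℝ, t₀ ≤ t → m ≤ F (ψ t)) :
    ∀ a : ℝ, ψ t₀ ≤ a → F a = F (ψ t₀) :=
  const_of_unbounded_clock_const hF hψ0 hunb (clock_const_of_concaveOn_of_le hF hψ hψ0 hconc hm)

/-! ## §2 Sector Ω-forms against an arbitrary unbounded clock -/

/-- **Eventual concavity of `ε_od` against ANY unbounded non-decreasing clock refutes RH**
(`ψ` non-decreasing on `[t₀, ∞)`, `ψ t₀ > 0`, `ψ` unbounded above there; e.g. `e^{κa}`, powers,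
logarithms, iterated exponentials): under RH `ε_od ≥ 0` (Yoshida), so §1 makes `ε_od` constant on
`[ψ t₀, ∞)`, which part 9 `weilOddGroundEnergy_not_eventually_const` excludes.  RH-free
implication; the shape hypothesis is NOT claimed; no RH claim. [folklore] -/
theorem not_riemannHypothesis_of_concaveOn_clock_odd {ψ : ℝ → ℝ} {t₀ : ℝ}
    (hψ : MonotoneOn ψ (Ici t₀)) (hψ0 : 0 < ψ t₀) (hunb : ∀ A : ℝ, ∃ t : ℝ, t₀ ≤ t ∧ A ≤ ψ t)
    (hconc : ConcaveOn ℝ (Ici t₀) (fun t : ℝ => weilOddGroundEnergy (ψ t))) :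
    ¬ _root_.RiemannHypothesis := fun hRH =>
  weilOddGroundEnergy_not_eventually_const hψ0 (weilOddGroundEnergy (ψ t₀))
    (const_of_concaveOn_unbounded_clock weilOddGroundEnergy_antitoneOn hψ hψ0 hunb hconc
      (m := 0) fun t _ => weilOddGroundEnergy_nonneg_of_riemannHypothesis hRH (ψ t))

/-- **Eventual concavity of `ε_ev` against ANY unbounded non-decreasing clock refutes RH**: under
RH `0 ≤ ε ≤ ε_ev`, so §1 makes `ε_ev` constant on `[ψ t₀, ∞)`, which part 9
`weilEvenGroundEnergy_not_eventually_const` excludes.  RH-free implication; the shape hypothesis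
is NOT claimed; no RH claim. [folklore] -/
theorem not_riemannHypothesis_of_concaveOn_clock_even {ψ : ℝ → ℝ} {t₀ : ℝ}
    (hψ : MonotoneOn ψ (Ici t₀)) (hψ0 : 0 < ψ t₀) (hunb : ∀ A : ℝ, ∃ t : ℝ, t₀ ≤ t ∧ A ≤ ψ t)
    (hconc : ConcaveOn ℝ (Ici t₀) (fun t : ℝ => weilEvenGroundEnergy (ψ t))) :
    ¬ _root_.RiemannHypothesis := by
  intro hRH
  have hm : ∀ t : ℝ, t₀ ≤ t → 0 ≤ weilEvenGroundEnergy (ψ t) := fun t ht =>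
    (weilGroundEnergy_nonneg_of_riemannHypothesis hRH
      (hψ0.trans_le (hψ self_mem_Ici (mem_Ici.2 ht) ht))).trans
      (weilGroundEnergy_le_weilEvenGroundEnergy (ψ t))
  exact weilEvenGroundEnergy_not_eventually_const hψ0 (weilEvenGroundEnergy (ψ t₀))
    (const_of_concaveOn_unbounded_clock weilEvenGroundEnergy_antitoneOn hψ hψ0 hunb hconc hm)

/-- Parity-free companion of part 8 `not_riemannHypothesis_of_concaveOn_clock` for NON-strict
clocks: eventual concavity of `t ↦ ε (ψ t)` along an unbounded non-decreasing clock refutes RH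
(under RH `ε ≥ 0`; §1 makes `ε` constant on `[ψ t₀, ∞)`, contradicting its STRICT decrease,
Bombieri).  RH-free implication; no RH claim. [folklore] -/
theorem not_riemannHypothesis_of_concaveOn_clock_mono {ψ : ℝ → ℝ} {t₀ : ℝ}
    (hψ : MonotoneOn ψ (Ici t₀)) (hψ0 : 0 < ψ t₀) (hunb : ∀ A : ℝ, ∃ t : ℝ, t₀ ≤ t ∧ A ≤ ψ t)
    (hconc : ConcaveOn ℝ (Ici t₀) (fun t : ℝ => weilGroundEnergy (ψ t))) :
    ¬ _root_.RiemannHypothesis := by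
  intro hRH
  have hm : ∀ t : ℝ, t₀ ≤ t → 0 ≤ weilGroundEnergy (ψ t) := fun t ht =>
    weilGroundEnergy_nonneg_of_riemannHypothesis hRH
      (hψ0.trans_le (hψ self_mem_Ici (mem_Ici.2 ht) ht))
  have hc := const_of_concaveOn_unbounded_clock weilGroundEnergy_antitoneOn hψ hψ0 hunb hconc hm
  have h1 : weilGroundEnergy (ψ t₀ + 1) < weilGroundEnergy (ψ t₀) :=
    weilGroundEnergy_strictAntiOn (mem_Ioi.2 hψ0) (mem_Ioi.2 (by linarith)) (by linarith)
  have h2 := hc (ψ t₀ + 1) (by linarith)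
  linarith

/-- **Both sectors at once, for the record**: along any unbounded non-decreasing clock, eventual
concavity of EITHER sector bottom refutes RH; equivalently, under RH neither `t ↦ ε_od (ψ t)` nor
`t ↦ ε_ev (ψ t)` is eventually concave.  proof.conditional; no RH claim. [folklore] -/
theorem not_concaveOn_clock_sectors_of_riemannHypothesis (hRH : _root_.RiemannHypothesis)
    {ψ : ℝ → ℝ} {t₀ : ℝ} (hψ : MonotoneOn ψ (Ici t₀)) (hψ0 : 0 < ψ t₀)
    (hunb : ∀ A : ℝ, ∃ t : ℝ, t₀ ≤ t ∧ A ≤ ψ t) :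
    ¬ ConcaveOn ℝ (Ici t₀) (fun t : ℝ => weilOddGroundEnergy (ψ t)) ∧
      ¬ ConcaveOn ℝ (Ici t₀) (fun t : ℝ => weilEvenGroundEnergy (ψ t)) :=
  ⟨fun h => not_riemannHypothesis_of_concaveOn_clock_odd hψ hψ0 hunb h hRH,
    fun h => not_riemannHypothesis_of_concaveOn_clock_even hψ hψ0 hunb h hRH⟩

end Summit.RiemannHypothesis.RiemannHypothesis.Theorems.PfPersistenceDefectiveTransport

end
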